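import Summits.AnomalousDissipation.AnomalousDissipation.Theses.PumpedMirror
import Summits.AnomalousDissipation.AnomalousDissipation.Theorems.TaylorGreenLoudGalerkinStates.Negative.Anatomy
import Literature.Analysis.FluidPDE.LerayHopfTimeSliceTorus

/-!
# Negative knowledge for the crux `MirrorBoundedFromRestTG` (stmt-AnomalousDissipation-15373, route PumpedMirror):
# the rest state is not a witness

Vetting lemma (refuter crux-attack, junk-model exclusion). The matrix of
`Summit.AnomalousDissipation.AnomalousDissipation.Theses.PumpedMirror.MirrorBoundedFromRestTG` asks, for every
small `ν`, for SOME global Leray–Hopf solution `u` of `NS_ν(f_TG)` from the zero datum with a K-symmetric `H`-lift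
of energy `≤ E`. The trivial field `u ≡ 0` (lift `U ≡ 0`) meets the lift clause, the Fix-K symmetry clause and every
energy ceiling, so the statement is non-trivial only if the Leray–Hopf predicate excludes it. It does: the rest
state is not even a forced weak solution of `NS_ν(f_TG)` from `0` on any `[0,T)`, `T > 0` — test the weak identity
of `Torus.IsWeakNSSolutionForcedOn` with the admissible divergence-free field `ψ(t,x) = η(t) f_TG(x)`, `η` a smooth
bump supported in `(0,T)`: every `u`-term vanishes and the identity reads `(∫ η) · ‖f_TG‖₂² = (∫ η)/4 = 0`, absurd
since `∫ η > 0` (`integral_norm_sq_tgForce`, `ContDiffBump.integral_pos`). Supports stmt-AnomalousDissipation-15373;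
asserts no route item. (`tgForce` is definitionally the crux's pinned lambda term, cf. `LoadBearing.crux_iff`.)
-/

noncomputable section

-- the mandated namespace `Summit.<Summit>.<Problem>.Theorems` repeats `AnomalousDissipation` (single-problem summit)
set_option linter.dupNamespace false

open scoped InnerProductSpace ContDiff
open MeasureTheory Set Filter
open Literature.Analysis.FunctionSpaces Literature.Analysis.FluidPDE
open Summit.AnomalousDissipation.AnomalousDissipation.Theorems.TaylorGreenLoudGalerkinStates.Negative

namespace Summit.AnomalousDissipation.AnomalousDissipation.Theorems.MirrorBoundedFromRestTG.Negative

/-- **The rest state is not a forced weak solution of `NS_ν(f_TG)` from the zero datum** on `[0,T)`, `T > 0`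
(test with `η(t) f_TG(x)`, `η` a bump in `(0,T)`: the identity would give `(∫ η)/4 = 0`). [folklore] -/
theorem zero_not_isWeakNSSolutionForcedOn_tgForce {T : ℝ} (ν : ℝ) (hT : 0 < T) :
    ¬ Torus.IsWeakNSSolutionForcedOn T ν (fun _ => tgForce) 0 (fun _ _ => 0) := by
  intro h
  let η : ContDiffBump (T / 2) := ⟨T / 8, T / 4, by positivity, by linarith⟩
  have hr : η.rOut = T / 4 := rfl
  have hηT : tsupport (η : ℝ → ℝ) ⊆ Iio T := by
    rw [η.tsupport_eq]
    intro t ht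
    rw [Metric.mem_closedBall, Real.dist_eq, abs_le, hr] at ht
    show t < T
    linarith [ht.2]
  have hψ : Torus.IsSpaceTimeTest T (fun s x => η s • tgForce x) :=
    Torus.isSpaceTimeTest_smul η.contDiff η.hasCompactSupport hηT isSmooth_tgForce
  have hdiv : Torus.IsDivFreeTest (fun s x => η s • tgForce x) :=
    Torus.isDivFreeTest_smul _ isDivFree_tgForce
  have hid := h.2.2.2 _ hψ hdiv
  simp only [inner_zero_left, mul_zero, zero_add, add_zero, Pi.zero_apply, integral_zero] at hid
  simp_rw [real_inner_smul_right, real_inner_self_eq_norm_sq, integral_const_mul, integral_norm_sq_tgForce,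
    integral_mul_const] at hid
  have hsupp : ∀ t, t ∉ Ioo 0 T → (η : ℝ → ℝ) t = 0 := by
    intro t ht
    by_contra h0
    have hb : t ∈ Metric.ball (T / 2) η.rOut := by
      rw [← η.support_eq]
      exact h0
    rw [Metric.mem_ball, Real.dist_eq, abs_lt, hr] at hb
    exact ht ⟨by linarith [hb.1], by linarith [hb.2]⟩
  rw [setIntegral_eq_integral_of_forall_compl_eq_zero hsupp] at hid
  have hpos : 0 < ∫ t, (η : ℝ → ℝ) t := η.integral_pos
  linarith

/-- **The rest state is not a global Leray–Hopf solution of `NS_ν(f_TG)` from the zero datum** (any `ν`): the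
`∃ u` of `MirrorBoundedFromRestTG` cannot be witnessed by `u ≡ 0`, although `U ≡ 0` meets its lift, symmetry and
energy clauses — the Leray–Hopf clause is load-bearing against the trivial model. [folklore] -/
theorem zero_not_isGlobalLerayHopf_tgForce (ν : ℝ) :
    ¬ Torus.IsGlobalLerayHopf ν (fun _ => tgForce) 0 (fun _ _ => 0) := fun h =>
  zero_not_isWeakNSSolutionForcedOn_tgForce ν one_pos (h 1 one_pos).weak

end Summit.AnomalousDissipation.AnomalousDissipation.Theorems.MirrorBoundedFromRestTG.Negative

end
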